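import Summits.QuantumFields.YangMills.Theorems.ConvexGribovBodyNonSimplyConnectedLatticeGapWeakMixingFunnel
import HarnessLib

/-!
# The Dobrushin–Shlosman finite-size condition at strong coupling
# (stub `stub_cellFiniteSize_smallBeta` (SC) of crux stmt-QuantumFields-16405, route `ConvexGribovBody`,
# line `Sketch` v8)

The strong-coupling calibration of the leaf of line `Sketch`: for EVERY compact metrisable group `G`, every
continuous representation `ρ` and every threshold `ε > 0` there is `β₁ > 0` such that the lattice Yang–Mills
specification `γ = ymSpecification ρ β` on `ℤ⁴` satisfies the Dobrushin–Shlosman total-variation finite-size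
condition at window `n = 1` and cell size `b = 1` (the hypothesis `hFS` of `FiniteSizeCriterion.box_influence_le`)
whenever `|β| < β₁`: for every grid `w` of cells of side `≤ 2`, every union `Λ` of cells indexed by
`Y ⊆ [−2,2]⁴` containing the cell of the origin, every pair of exterior data `η, η'` and every measurable cylinder
function `0 ≤ f ≤ 1` of the links of the origin cell, `|γ_Λ(f | η) − γ_Λ(f | η')| ≤ ε`.

Proof. The kernel `γ_Λ(· | η)` is the `η`-glued Haar product measure `P_η` tilted by `e^{−β S_Λ}`
(`integral_ymSpecification`: `γ_Λ(f | η) = ∫ F a dP / ∫ a dP` with `F ζ = f(ζ η_{Λᶜ})`, `a ζ = e^{−β S_Λ(ζ η_{Λᶜ})}`,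
`P` the Haar product over the links of `Λ`). (i) Uniform action bound: `|S_Λ| ≤ K` for all configurations and all
admissible `(w, Y)`, since at most `40000 · 5 · #{planes}` plaquettes touch a union of `≤ 5⁴` cells of `≤ 2⁴ · 4`
links each and `|N − Re tr ρ(U_p)| ≤ N + max_G |Re tr ρ|` (`ρ` continuous on the compact group). (ii) Density
bound: `a ∈ [e^{−|β|K}, e^{|β|K}]`, so `|∫ F a dP / ∫ a dP − ∫ F dP| ≤ e^{2|β|K} − 1` for `0 ≤ F ≤ 1`
(`smallBeta_abs_div_integral_sub_le`). (iii) The un-tilted mean `∫ F dP` does not see `η`: on `Λ ⊇ cell(0)` the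
glued configuration is `ζ` for every `η`, and `f` is a cylinder function of the origin cell. (iv) Hence the
influence is `≤ 2(e^{2|β|K} − 1) ≤ ε` once `|β| < β₁ := log(1 + ε/2) / (2K)`.

References: R. L. Dobrushin, S. B. Shlosman, *Constructive criterion for the uniqueness of Gibbs field* (1985), §2
(high-temperature verification of the finite-size condition); K. Osterwalder, E. Seiler, Ann. Phys. 110 (1978), §4
(strong coupling); H.-O. Georgii, *Gibbs Measures and Phase Transitions* (2011), Def. 2.9, §8.1.
-/

set_option autoImplicit false

noncomputable section

open MeasureTheory Filter
open Literature.Probability.LatticeModels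
open Literature.MathematicalPhysics.QuantumLattice
open Literature.MathematicalPhysics.QuantumFieldTheory (haarProbability)

namespace Summit.QuantumFields.YangMills.Theorems.NonSimplyConnectedLatticeGap

/-! ## (ii) The density bound: tilting a probability measure by a density in `[L, U]` -/

/-- **Ratio perturbation bound.** For a probability measure `P`, a measurable `0 ≤ F ≤ 1` and a measurable weight
`a` with values in `[L, U]`, `0 < L`, the normalised tilted mean `∫ F a dP / ∫ a dP` is within `U/L − 1` of the
un-tilted mean `∫ F dP`: indeed `Z = ∫ a dP ∈ [L, U]`, `|a/Z − 1| = |a − Z|/Z ≤ (U − L)/L`. -/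
theorem smallBeta_abs_div_integral_sub_le {X : Type*} [MeasurableSpace X] (P : Measure X)
    [IsProbabilityMeasure P] {F a : X → ℝ} (hFm : Measurable F) (ham : Measurable a)
    (hF : ∀ x, 0 ≤ F x ∧ F x ≤ 1) {L U : ℝ} (hL : 0 < L) (hLa : ∀ x, L ≤ a x) (haU : ∀ x, a x ≤ U) :
    |(∫ x, F x * a x ∂P) / (∫ x, a x ∂P) - ∫ x, F x ∂P| ≤ U / L - 1 := by
  have ha0 : ∀ x, 0 ≤ a x := fun x => hL.le.trans (hLa x)
  have haabs : ∀ x, |a x| ≤ U := fun x => by rw [abs_of_nonneg (ha0 x)]; exact haU x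
  have hFabs : ∀ x, |F x| ≤ 1 := fun x => by rw [abs_of_nonneg (hF x).1]; exact (hF x).2
  have ha_int : Integrable a P := integrable_of_abs_le ham haabs
  have hF_int : Integrable F P := integrable_of_abs_le hFm hFabs
  have hFa_int : Integrable (fun x => F x * a x) P :=
    integrable_of_abs_le (hFm.mul ham) (C := U) fun x => by
      rw [abs_mul]
      calc |F x| * |a x| ≤ 1 * U := mul_le_mul (hFabs x) (haabs x) (abs_nonneg _) zero_le_one
        _ = U := one_mul U
  set Z : ℝ := ∫ x, a x ∂P with hZ
  have hZL : L ≤ Z := by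
    have h := integral_mono (integrable_const L) ha_int fun x => hLa x
    simpa using h
  have hZU : Z ≤ U := by
    have h := integral_mono ha_int (integrable_const U) fun x => haU x
    simpa using h
  have hZ0 : 0 < Z := hL.trans_le hZL
  have hsub : (∫ x, F x * a x ∂P) / Z - ∫ x, F x ∂P = ∫ x, F x * (a x / Z - 1) ∂P := by
    rw [← integral_div, ← integral_sub (hFa_int.div_const Z) hF_int]
    refine integral_congr_ae (ae_of_all _ fun x => ?_)
    simp only
    ring
  rw [hsub]
  refine abs_integral_le_of_abs_le fun x => ?_
  have h2 : |a x / Z - 1| ≤ U / L - 1 := by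
    have e : a x / Z - 1 = (a x - Z) / Z := by field_simp
    rw [e, abs_div, abs_of_pos hZ0]
    have h3 : |a x - Z| ≤ U - L := by
      rw [abs_sub_le_iff]
      constructor <;> linarith [haU x, hLa x]
    calc |a x - Z| / Z ≤ (U - L) / Z := div_le_div_of_nonneg_right h3 hZ0.le
      _ ≤ (U - L) / L := div_le_div_of_nonneg_left (by linarith) hL hZL
      _ = U / L - 1 := by rw [sub_div, div_self hL.ne']
  rw [abs_mul]
  calc |F x| * |a x / Z - 1| ≤ 1 * (U / L - 1) := mul_le_mul (hFabs x) h2 (abs_nonneg _) zero_le_one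
    _ = U / L - 1 := one_mul _

/-! ## (i) The uniform action bound -/

/-- At most `(|Λ| + |Λ|·d) · #{planes}` plaquettes touch a finite link set `Λ` (the defining finite image of
`plaquettesTouching`: base point `x` or `x − e_k` for a link `(x, i) ∈ Λ`, any plane). -/
theorem smallBeta_card_plaquettesTouching_le {d : ℕ} (Λ : Finset (ZdEdge d)) :
    (plaquettesTouching Λ).card ≤
      (Λ.card + Λ.card * d) * Fintype.card {p : Fin d × Fin d // p.1 < p.2} := by
  classical
  unfold plaquettesTouching
  refine (Finset.card_filter_le _ _).trans ?_
  rw [Finset.card_product, Finset.card_univ]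
  refine Nat.mul_le_mul_right _ ?_
  refine (Finset.card_union_le _ _).trans (add_le_add Finset.card_image_le ?_)
  refine Finset.card_image_le.trans ?_
  rw [Finset.card_product, Finset.card_univ, Fintype.card_fin]

/-- A union of cells of a grid `w` of cells of side `≤ 2`, indexed by `Y ⊆ [−2,2]⁴`, has at most `625 · 64` links
(`|Y| ≤ 5⁴`, each cell has `≤ 2⁴` sites and `4` directions). -/
theorem smallBeta_card_cellUnion_le (w : Fin 4 → ℤ → ℤ)
    (hw : ∀ i j, w i j + ((1 : ℕ) : ℤ) ≤ w i (j + 1) ∧ w i (j + 1) ≤ w i j + 2 * ((1 : ℕ) : ℤ))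
    (Y : Finset (Fin 4 → ℤ))
    (hY : Y ⊆ (Fintype.piFinset fun _ : Fin 4 => Finset.Icc (-(2 * ((1 : ℕ) : ℤ))) (2 * ((1 : ℕ) : ℤ)))) :
    (Y.biUnion (fun y : Fin 4 → ℤ => (Fintype.piFinset fun i : Fin 4 => Finset.Ico (w i (y i)) (w i (y i + 1))) ×ˢ
      (Finset.univ : Finset (Fin 4)))).card ≤ 625 * 64 := by
  classical
  refine Finset.card_biUnion_le.trans ?_
  have hYc : Y.card ≤ 625 := by
    refine (Finset.card_le_card hY).trans ?_
    rw [Fintype.card_piFinset]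
    simp
  have hcell : ∀ y ∈ Y, ((Fintype.piFinset fun i : Fin 4 => Finset.Ico (w i (y i)) (w i (y i + 1))) ×ˢ
      (Finset.univ : Finset (Fin 4))).card ≤ 64 := by
    intro y _
    rw [Finset.card_product, Finset.card_univ, Fintype.card_fin, Fintype.card_piFinset]
    have hI : ∀ i : Fin 4, (Finset.Ico (w i (y i)) (w i (y i + 1))).card ≤ 2 := fun i => by
      rw [Int.card_Ico]
      have h2 := (hw i (y i)).2
      push_cast at h2
      exact Int.toNat_le.2 (by push_cast; linarith)
    calc (∏ i : Fin 4, (Finset.Ico (w i (y i)) (w i (y i + 1))).card) * 4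
        ≤ (∏ _i : Fin 4, 2) * 4 :=
          Nat.mul_le_mul_right _ (Finset.prod_le_prod (fun i _ => Nat.zero_le _) fun i _ => hI i)
      _ = 64 := by simp
  calc ∑ y ∈ Y, ((Fintype.piFinset fun i : Fin 4 => Finset.Ico (w i (y i)) (w i (y i + 1))) ×ˢ
        (Finset.univ : Finset (Fin 4))).card ≤ ∑ _y ∈ Y, 64 := Finset.sum_le_sum hcell
    _ = Y.card * 64 := by simp
    _ ≤ 625 * 64 := Nat.mul_le_mul_right _ hYc

section ActionBound

variable {N : ℕ} {G : Type} [Group G] (ρ : G →* Matrix (Fin N) (Fin N) ℂ)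

/-- If `|Re tr ρ(g)| ≤ M` on `G`, the boundary Wilson action of `Λ` is bounded by `#(plaquettes touching Λ) · (N + M)`
(triangle inequality, term by term). -/
theorem smallBeta_abs_wilsonBoundaryAction_le {M : ℝ} (hM : ∀ g, |(ρ g).trace.re| ≤ M) {d : ℕ}
    (Λ : Finset (ZdEdge d)) (U : LGConfig d G) :
    |wilsonBoundaryAction ρ Λ U| ≤ (plaquettesTouching Λ).card * ((N : ℝ) + M) := by
  unfold wilsonBoundaryAction
  calc |∑ p ∈ plaquettesTouching Λ, ((N : ℝ) - plaquetteObs ρ p.1 p.2.1.1 p.2.1.2 U)|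
      ≤ ∑ p ∈ plaquettesTouching Λ, |(N : ℝ) - plaquetteObs ρ p.1 p.2.1.1 p.2.1.2 U| :=
        Finset.abs_sum_le_sum_abs _ _
    _ ≤ ∑ _p ∈ plaquettesTouching Λ, ((N : ℝ) + M) := Finset.sum_le_sum fun p _ => by
        refine (abs_sub _ _).trans (add_le_add (le_of_eq (Nat.abs_cast N)) ?_)
        exact hM _
    _ = (plaquettesTouching Λ).card * ((N : ℝ) + M) := by rw [Finset.sum_const, nsmul_eq_mul]

variable [TopologicalSpace G] [CompactSpace G]

/-- **Uniform action bound**: for a continuous representation of a compact group there is `K > 0` with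
`|S_Λ(U)| ≤ K` for every configuration `U` and every cell union `Λ` of the finite-size condition at `n = b = 1`. -/
theorem smallBeta_exists_actionBound (hρ : Continuous ρ) :
    ∃ K : ℝ, 0 < K ∧ ∀ w : Fin 4 → ℤ → ℤ,
      (∀ i j, w i j + ((1 : ℕ) : ℤ) ≤ w i (j + 1) ∧ w i (j + 1) ≤ w i j + 2 * ((1 : ℕ) : ℤ)) →
      ∀ Y : Finset (Fin 4 → ℤ),
        Y ⊆ (Fintype.piFinset fun _ : Fin 4 => Finset.Icc (-(2 * ((1 : ℕ) : ℤ))) (2 * ((1 : ℕ) : ℤ))) →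
      ∀ U : LGConfig 4 G, |wilsonBoundaryAction ρ (Y.biUnion (fun y : Fin 4 → ℤ =>
          (Fintype.piFinset fun i : Fin 4 => Finset.Ico (w i (y i)) (w i (y i + 1))) ×ˢ
            (Finset.univ : Finset (Fin 4)))) U| ≤ K := by
  obtain ⟨M, hM⟩ := exists_bound_of_continuous (X := G) (f := fun g => (ρ g).trace.re)
    (Complex.continuous_re.comp hρ.matrix_trace)
  have hM0 : 0 ≤ M := (abs_nonneg _).trans (hM 1)
  set Pmax : ℕ := (625 * 64 + 625 * 64 * 4) * Fintype.card {p : Fin 4 × Fin 4 // p.1 < p.2} with hPmax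
  refine ⟨(Pmax : ℝ) * ((N : ℝ) + M) + 1, by positivity, ?_⟩
  intro w hw Y hY U
  have hcard : (plaquettesTouching (Y.biUnion (fun y : Fin 4 → ℤ =>
      (Fintype.piFinset fun i : Fin 4 => Finset.Ico (w i (y i)) (w i (y i + 1))) ×ˢ
        (Finset.univ : Finset (Fin 4))))).card ≤ Pmax := by
    refine (smallBeta_card_plaquettesTouching_le _).trans ?_
    rw [hPmax]
    have hΛ := smallBeta_card_cellUnion_le w hw Y hY
    refine Nat.mul_le_mul_right _ (add_le_add hΛ (Nat.mul_le_mul_right _ hΛ))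
  calc _ ≤ ((plaquettesTouching (Y.biUnion (fun y : Fin 4 → ℤ =>
      (Fintype.piFinset fun i : Fin 4 => Finset.Ico (w i (y i)) (w i (y i + 1))) ×ˢ
        (Finset.univ : Finset (Fin 4))))).card : ℝ) * ((N : ℝ) + M) :=
        smallBeta_abs_wilsonBoundaryAction_le ρ hM _ U
    _ ≤ (Pmax : ℝ) * ((N : ℝ) + M) := by
        refine mul_le_mul_of_nonneg_right ?_ (by positivity)
        exact_mod_cast hcard
    _ ≤ (Pmax : ℝ) * ((N : ℝ) + M) + 1 := by linarith

end ActionBound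

/-! ## (iii)–(iv) The influence bound at a fixed volume -/

section Influence

variable {N : ℕ} {G : Type} [Group G] [TopologicalSpace G] [IsTopologicalGroup G]
  [CompactSpace G] [MeasurableSpace G] [BorelSpace G] [SecondCountableTopology G]
  (ρ : G →* Matrix (Fin N) (Fin N) ℂ)

/-- **Influence bound from an action bound.** If `|S_Λ| ≤ K` and the measurable `0 ≤ f ≤ 1` is a cylinder function
of a link set `S₀ ⊆ Λ`, then `|γ_Λ(f | η) − γ_Λ(f | η')| ≤ 2 (e^{2|β|K} − 1)` for all exterior data `η, η'`: both
kernel means are within `e^{2|β|K} − 1` of the common un-tilted mean `∫ f(ζ η_{Λᶜ}) dζ = ∫ f(ζ η'_{Λᶜ}) dζ`. -/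
theorem smallBeta_influence_le (hρ : Continuous ρ) (β : ℝ) (Λ : Finset (ZdEdge 4)) {K : ℝ}
    (hK : ∀ U, |wilsonBoundaryAction ρ Λ U| ≤ K) {f : LGConfig 4 G → ℝ} {S₀ : Finset (ZdEdge 4)}
    (hS₀ : S₀ ⊆ Λ) (hfS : IsCylinder f S₀) (hfm : Measurable f) (hf : ∀ U, 0 ≤ f U ∧ f U ≤ 1)
    (η η' : LGConfig 4 G) :
    |(∫ U, f U ∂(ymSpecification ρ β Λ η)) - ∫ U, f U ∂(ymSpecification ρ β Λ η')| ≤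
      2 * (Real.exp (2 * (|β| * K)) - 1) := by
  rw [integral_ymSpecification ρ hρ β Λ hfm η, integral_ymSpecification ρ hρ β Λ hfm η']
  -- the un-tilted integrand does not see the exterior datum
  have hF : ∀ ζ : ↥Λ → G, f (glueWith Λ ζ η') = f (glueWith Λ ζ η) := fun ζ =>
    hfS fun e he => by
      have heΛ : e ∈ Λ := hS₀ (Finset.mem_coe.1 he)
      rw [glueWith_apply_mem _ _ _ heΛ, glueWith_apply_mem _ _ _ heΛ]
  simp only [hF]
  -- the density bound for each exterior datum
  have hFm : Measurable fun ζ : ↥Λ → G => f (glueWith Λ ζ η) := hfm.comp (measurable_glueWith Λ η)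
  have key : ∀ ξ : LGConfig 4 G,
      |(∫ ζ, f (glueWith Λ ζ η) * Real.exp (-β * wilsonBoundaryAction ρ Λ (glueWith Λ ζ ξ))
          ∂(Measure.pi fun _ : ↥Λ => haarProbability G)) /
        (∫ ζ, Real.exp (-β * wilsonBoundaryAction ρ Λ (glueWith Λ ζ ξ))
          ∂(Measure.pi fun _ : ↥Λ => haarProbability G)) -
        ∫ ζ, f (glueWith Λ ζ η) ∂(Measure.pi fun _ : ↥Λ => haarProbability G)| ≤
        Real.exp (2 * (|β| * K)) - 1 := fun ξ => by
    have ham : Measurable fun ζ : ↥Λ → G =>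
        Real.exp (-β * wilsonBoundaryAction ρ Λ (glueWith Λ ζ ξ)) :=
      Real.measurable_exp.comp (measurable_const.mul
        ((continuous_wilsonBoundaryAction ρ hρ Λ).measurable.comp (measurable_glueWith Λ ξ)))
    have hexpnt : ∀ U : LGConfig 4 G, |-β * wilsonBoundaryAction ρ Λ U| ≤ |β| * K := fun U => by
      rw [abs_mul, abs_neg]
      exact mul_le_mul_of_nonneg_left (hK U) (abs_nonneg β)
    have hLa : ∀ ζ : ↥Λ → G, Real.exp (-(|β| * K)) ≤
        Real.exp (-β * wilsonBoundaryAction ρ Λ (glueWith Λ ζ ξ)) := fun ζ =>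
      Real.exp_le_exp.2 (neg_le_of_abs_le (hexpnt _))
    have haU : ∀ ζ : ↥Λ → G, Real.exp (-β * wilsonBoundaryAction ρ Λ (glueWith Λ ζ ξ)) ≤
        Real.exp (|β| * K) := fun ζ =>
      Real.exp_le_exp.2 (le_of_abs_le (hexpnt _))
    have h := smallBeta_abs_div_integral_sub_le (Measure.pi fun _ : ↥Λ => haarProbability G) hFm ham
      (fun ζ => hf _) (Real.exp_pos _) hLa haU
    have hUL : Real.exp (|β| * K) / Real.exp (-(|β| * K)) = Real.exp (2 * (|β| * K)) := by
      rw [← Real.exp_sub]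
      ring_nf
    rwa [hUL] at h
  have h1 := key η
  have h2 := key η'
  rw [abs_sub_le_iff] at h1 h2
  rw [abs_sub_le_iff]
  constructor <;> linarith [h1.1, h1.2, h2.1, h2.2]

end Influence

/-! ## The stub -/

/-- **STUB SC — the Dobrushin–Shlosman finite-size condition holds at strong coupling** (registered stub
`stub_cellFiniteSize_smallBeta` of the skeleton `Cruxes/NonSimplyConnectedLatticeGap/Lines/Sketch.lean` v8 of item
stmt-QuantumFields-16405): at window `n = 1`, cell size `b = 1` and any threshold `ε > 0` there is `β₁ > 0` such that
the total-variation finite-size condition (hypothesis `hFS` of `FiniteSizeCriterion.box_influence_le`) holds for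
`ymSpecification ρ β` whenever `|β| < β₁`; `β₁ = log(1 + ε/2) / (2K)` with `K` the uniform action bound of
`smallBeta_exists_actionBound`. -/
theorem stub_cellFiniteSize_smallBeta : ∀ (G : Type) [Group G] [TopologicalSpace G] [IsTopologicalGroup G] [CompactSpace G] [MeasurableSpace G] [BorelSpace G] [SecondCountableTopology G] [T2Space G] (N : ℕ) (ρ : G →* Matrix (Fin N) (Fin N) ℂ), Continuous ρ → ∀ (ε : ℝ), 0 < ε → ∃ β₁ : ℝ, 0 < β₁ ∧ ∀ β : ℝ, |β| < β₁ → (∀ w : Fin 4 → ℤ → ℤ, (∀ i j, w i j + ((1 : ℕ) : ℤ) ≤ w i (j + 1) ∧ w i (j + 1) ≤ w i j + 2 * ((1 : ℕ) : ℤ)) → ∀ Y : Finset (Fin 4 → ℤ), Y ⊆ (Fintype.piFinset fun _ : Fin 4 => Finset.Icc (-(2 * ((1 : ℕ) : ℤ))) (2 * ((1 : ℕ) : ℤ))) → (0 : Fin 4 → ℤ) ∈ Y → ∀ η η' : Literature.MathematicalPhysics.QuantumLattice.LGConfig 4 G, (∀ e ∈ (Fintype.piFinset fun _ : Fin 4 =>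 Finset.Icc (-(2 * ((1 : ℕ) : ℤ))) (2 * ((1 : ℕ) : ℤ))).biUnion (fun y : Fin 4 → ℤ => (Fintype.piFinset fun i : Fin 4 => Finset.Ico (w i (y i)) (w i (y i + 1))) ×ˢ (Finset.univ : Finset (Fin 4))), η e = η' e) → ∀ f : Literature.MathematicalPhysics.QuantumLattice.LGConfig 4 G → ℝ, Literature.MathematicalPhysics.QuantumLattice.IsCylinder f ((fun y : Fin 4 → ℤ => (Fintype.piFinset fun i : Fin 4 => Finset.Ico (w i (y i)) (w i (y i + 1))) ×ˢ (Finset.univ : Finset (Fin 4))) 0) → Measurable f → (∀ U, 0 ≤ f U ∧ f U ≤ 1) → |(∫ U, f U ∂(Literature.MathematicalPhysics.QuantumLattice.ymSpecification ρ β (Y.biUnion (fun y : Fin 4 → ℤ => (Fintype.piFinset fun i : Fin 4 => Finset.Ico (w i (y i)) (w i (y i + 1))) ×ˢ (Finset.univ : Finset (Fin 4)))) η)) - ∫ U, f U ∂(Literature.MathematicalPhysics.QuantumLattice.ymSpecification ρ β (Y.biUnion (fun y : Fin 4 → ℤ => (Fintype.piFinset fun i : Fin 4 => Finset.Ico (w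 i (y i)) (w i (y i + 1))) ×ˢ (Finset.univ : Finset (Fin 4)))) η')| ≤ ε) := by
  intro G _ _ _ _ _ _ _ _ N ρ hρ ε hε
  obtain ⟨K, hK0, hK⟩ := smallBeta_exists_actionBound ρ hρ
  have hlog : 0 < Real.log (1 + ε / 2) := Real.log_pos (by linarith)
  refine ⟨Real.log (1 + ε / 2) / (2 * K), div_pos hlog (by positivity), ?_⟩
  intro β hβ w hw Y hY h0Y η η' _hηη' f hfS hfm hf01
  -- `2 (e^{2|β|K} − 1) ≤ ε`
  have hexp : 2 * (Real.exp (2 * (|β| * K)) - 1) ≤ ε := by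
    have h1 : 2 * (|β| * K) < Real.log (1 + ε / 2) := by
      have h := (lt_div_iff₀ (by positivity : (0 : ℝ) < 2 * K)).1 hβ
      have e : |β| * (2 * K) = 2 * (|β| * K) := by ring
      linarith
    have h2 : Real.exp (2 * (|β| * K)) < 1 + ε / 2 := by
      calc Real.exp (2 * (|β| * K)) < Real.exp (Real.log (1 + ε / 2)) := Real.exp_lt_exp.2 h1
        _ = 1 + ε / 2 := Real.exp_log (by linarith)
    linarith
  classical
  exact (smallBeta_influence_le ρ hρ β _ (hK w hw Y hY)
    (Finset.subset_biUnion_of_mem (fun y : Fin 4 → ℤ =>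
      (Fintype.piFinset fun i : Fin 4 => Finset.Ico (w i (y i)) (w i (y i + 1))) ×ˢ
        (Finset.univ : Finset (Fin 4))) h0Y) hfS hfm hf01 η η').trans hexp

end Summit.QuantumFields.YangMills.Theorems.NonSimplyConnectedLatticeGap
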